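import Literature.AlgebraicGeometry.HodgeTheory.GenericAbelianSurfacePowersHodgeClasses
import Literature.AlgebraicGeometry.Motives.HodgeThetaSubalgebraSymplecticRankSixHodge
import HarnessLib

/-!
# Hodge classes on all powers of a generic abelian THREEFOLD are generated by divisor classes
# (Moonen–Zarhin 1999 §2 (2.3) Type I(1) with p. 715: `Hg(X) = Sp(V, φ) ≅ Sp_{6,ℚ}`, hence `B(Xⁿ) = D(Xⁿ)` for all
# `n` and the Hodge conjecture for all `Xⁿ`; = Tankeev–Ribet at the prime `p = 3` in the generic case)

Family `hodge`, layer `Literature/AlgebraicGeometry/HodgeTheory`. Research context: cell `pub-hodge-ring2` (HONEST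
FRAMING: research route conditional on HC_CM; not a corollary; Q11.4-sentence-2 already refuted in dim ≥ 3),
Literature lane, programme R13 «generic abelian threefolds», THE ASSEMBLY. UNCONDITIONAL for the class of abelian
varieties it names; theorems only, no definition, no named fact (D-0026), no `sorry`.

This file is the rank-six twin of `GenericAbelianSurfacePowersHodgeClasses` (R11-2): the invariance theorem,
`B = D` for abelian varieties with slots over `A`, and the threefold corollaries are the same assembly with
`dim_ℚ H¹ = 6`, the Lie step being `HodgeStructure.SymplecticThetaSix.wordDerAt_eq_zero_of_skew` (the rank-six
Θ-subalgebra theorem, `…SymplecticRankSixHodge`) instead of the rank-four one. MZ99 (2.3) [corpus: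
paper:arxiv-math_9901113 p0005 L84–L86]: «g = 3. … Type 1(1): X is an abelian 3-fold with End⁰(X) = ℚ. Then
Hg(X) = Sp(V,φ) ≅ Sp_{6,ℚ}»; p0005 L19–L22: «For g := dim(X) ≤ 3 … we always find that Hg(X) = Sp_D(V,φ) … B(Xⁿ) =
D(Xⁿ) for all n … In particular the Hodge conjecture is true for all such Xⁿ».

## References

* [MoonenZarhin1999LowDim] B. Moonen, Yu. Zarhin, Math. Ann. 315 (1999), §2 (2.3), p. 715, §1 (1.8).
* [Milne1999LefschetzClasses] J. S. Milne, Lefschetz classes on abelian varieties, Duke Math. J. 96 (1999),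
  Prop. 3.6 (a), Cor. 4.5.
* [Gordon1997] B. B. Gordon, A survey of the Hodge conjecture for abelian varieties (1997), Thm. 7.5, §6.
* [vanGeemen1994HodgeAV] B. van Geemen, LNM 1594 (1994), §2.4–2.5, Lemma 3.7.
* [Tankeev1996] S. G. Tankeev, Cycles on abelian varieties of prime dimension over finite and number fields /
  algebraic cycles on simple abelian varieties of prime dimension (Thm. 1.1).
* [Deligne1982HodgeCycles] P. Deligne, Hodge cycles on abelian varieties, LNM 900 (1982), I §3.
-/

noncomputable section

open scoped TensorProduct
open scoped Matrix
open CategoryTheory Module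


/-! ### §2 The invariance theorem in rank six -/

namespace Literature.AlgebraicGeometry.HodgeTheory

open Literature.AlgebraicTopology.SingularHomology
open Literature.AlgebraicGeometry.Motives (IsSmoothProjective AbelianVariety bettiCohomology
  ofRatClassBaseChange ofRatClassBaseChange_tmul HodgeTensorFacts hodgeTensorFacts_holds)
open Literature.Barriers.HodgeConjecture
open Literature.AlgebraicGeometry.Motives.HodgeStructure
open Literature.RepresentationTheory.GeneralLinear
open Literature.RepresentationTheory.ClassicalInvariants
open Literature.NumberTheory.DiophantineGeometry

section Invariance

variable {A B : AbelianVariety ℂ} {n : ℕ} {g : Fin n → (B ⟶ A)}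

open scoped Classical in
/-- **THE INVARIANCE THEOREM (MZ99 (2.3) with (1.8), Lie step, for abelian varieties with slots over `A` of
generic rank-six type).** Let `A` be a complex abelian variety whose `H = H¹(A(ℂ); ℚ)` has `dim_ℚ H = 6` and
`End_Hdg(H) = ℚ`, with a polarization `ψ` and a symplectic Hodge basis `cb` (`exists_symplecticHodgeBasis`),
read in letters `Fin M` through `e : Fin m ⊕ Fin m ≃ Fin M` (Gram matrix `Ω = J` reindexed), and `B` an abelian
variety with slots `g` over `A`. Then every rational `(p,p)`-class `c` on `B` (`p ≥ 1`) is `∑_w a(w)·(g cb)_w`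
for a coefficient function `a` on words in the letters `(j, i)` (slot, letter) such that for every slot word `U`
and EVERY `X ∈ 𝔰𝔭(Ω)` (`Xᵀ Ω + Ω X = 0`) the diagonal derivation of `X` kills the slice `a(U, −)`: the operator
`Y_X` of `H_ℂ` with matrix `X` in the letters is `ψ_ℂ`-skew, so THEOREM L-Sp
(`HodgeStructure.SymplecticThetaSix.wordDerAt_eq_zero_of_skew`: the rational annihilator of the rational coefficient
tensor is an admissible Lie algebra containing `Θ` after complexification, hence all of `𝔰𝔭(H_ℂ, ψ_ℂ)` since
`Lie Hg = 𝔰𝔭₆`) applies; the transport between symplectic and rational letters is that of the tree's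
`AVSlots.exists_unitaryInvariant_coeff`. MZ99 p. 715: "`Hg(X) = Sp_D(V,φ)` […] it follows that
`B(Xⁿ) = D(Xⁿ)` for all `n`". [cite: MoonenZarhin1999LowDim, §2 (2.3), p. 715 and §1 (1.8)]
[cite: Gordon1997, Thm. 7.5 and §6 (p. 19)] [cite: vanGeemen1994HodgeAV, Thm. 4.2] -/
theorem AVSlots.exists_symplecticInvariant_coeff_six [HodgeTensorFacts.{0, 0}] (hg : AVSlots A B g)
    (hHD : exists_isReal_hodgeModel) (hI : hodgePQ_independent_of_hodgeModel)
    (ψ : (BettiUniverse.hodge hHD (AbelianVariety.isSmoothProjective_holds (A := A)) 1).Polarization)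
    (hE : ∀ a ∈ (BettiUniverse.hodge hHD (AbelianVariety.isSmoothProjective_holds (A := A)) 1).endAlg,
      ∃ x : ℚ, a = x • 1)
    (hV : Module.finrank ℚ (bettiCohomology A.X 1) = 6)
    {m M : ℕ} (cb : Module.Basis (Fin m ⊕ Fin m) ℂ (ℂ ⊗[ℚ] bettiCohomology A.X 1)) (e : Fin m ⊕ Fin m ≃ Fin M)
    (hcb10 : ∀ k, cb (Sum.inr k) ∈
      (BettiUniverse.hodge hHD (AbelianVariety.isSmoothProjective_holds (A := A)) 1).piece 1 0)
    (hcb01 : ∀ k, cb (Sum.inl k) ∈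
      (BettiUniverse.hodge hHD (AbelianVariety.isSmoothProjective_holds (A := A)) 1).piece 0 1)
    (hgram : ∀ s s', ψ.form.baseChange ℂ (cb s) (cb s') = Matrix.J (Fin m) ℂ s s')
    {p : ℕ} (hp : 0 < p) {c : complexBetti B.X (2 * p)} (hcQ : IsRationalClass c)
    (hc : IsOfHodgeType B.dim B.X (2 * p) p p c) :
    ∃ a : (Fin (2 * p) → Fin n × Fin M) → ℂ,
      wordEval (cupPowOneAlt ℂ (Motives.ComplexPoints B.X) (2 * p))
        (avLetters g fun i : Fin M => ofRatClassBaseChange (Motives.ComplexPoints A.X) 1 (cb (e.symm i))) a = c ∧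
      ∀ (U : Fin (2 * p) → Fin n) (X : Matrix (Fin M) (Fin M) ℂ),
        Xᵀ * Matrix.reindex e e (Matrix.J (Fin m) ℂ) + Matrix.reindex e e (Matrix.J (Fin m) ℂ) * X = 0 →
        wordDerAt ℂ (fun _ : Fin (2 * p) => X) (wordSlice a U) = 0 := by
  classical
  -- the setting
  have hX : IsSmoothProjective A.dim A.X := AbelianVariety.isSmoothProjective_holds
  haveI : Module.Finite ℚ (bettiCohomology A.X 1) := finite_bettiCohomology_one A
  have hn1 : (((1 : ℕ) : ℤ)) = 1 := Nat.cast_one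
  have heff := BettiUniverse.hodge_isEffective hHD hX 1
  set F := cupPowOneAlt ℂ (Motives.ComplexPoints B.X) (2 * p) with hFdef
  have hFinj : Function.Injective (exteriorPower.alternatingMapLinearEquiv F) :=
    injective_alternatingMapLinearEquiv_cupPowOneAlt B (2 * p)
  -- bases indexed by `Fin M`: the symplectic Hodge basis `cbσ` and a rational basis `eC`
  set cbσ : Module.Basis (Fin M) ℂ (ℂ ⊗[ℚ] bettiCohomology A.X 1) := cb.reindex e with hcbσdef
  have hcbσ : ∀ i, cbσ i = cb (e.symm i) := fun i => by rw [hcbσdef, Module.Basis.reindex_apply]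
  have hM : Module.finrank ℚ (bettiCohomology A.X 1) = M := by
    have h := Module.finrank_eq_card_basis cbσ
    rwa [Module.finrank_baseChange, Fintype.card_fin] at h
  set eQ : Module.Basis (Fin M) ℚ (bettiCohomology A.X 1) := Module.finBasisOfFinrankEq ℚ _ hM with heQ
  set eC : Module.Basis (Fin M) ℂ (ℂ ⊗[ℚ] bettiCohomology A.X 1) := Algebra.TensorProduct.basis ℂ eQ with heC
  -- kinds of the letters: `inl ↦ f ∈ H^{0,1}` (kind `1`), `inr ↦ e ∈ H^{1,0}` (kind `0`)
  set κ' : Fin M → Fin 2 := fun i => Sum.elim (fun _ => (1 : Fin 2)) (fun _ => 0) (e.symm i) with hκ'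
  have hkind : ∀ i,
      (κ' i = 0 ∧ cbσ i ∈ (BettiUniverse.hodge hHD (AbelianVariety.isSmoothProjective_holds (A := A)) 1).piece 1 0) ∨
      (κ' i = 1 ∧ cbσ i ∈ (BettiUniverse.hodge hHD (AbelianVariety.isSmoothProjective_holds (A := A)) 1).piece 0 1) := by
    intro i
    rw [hcbσ]
    simp only [hκ']
    rcases e.symm i with k | k
    · exact Or.inr ⟨rfl, hcb01 k⟩
    · exact Or.inl ⟨rfl, hcb10 k⟩
  have hkind0 : ∀ i, κ' i = 0 →
      cbσ i ∈ (BettiUniverse.hodge hHD (AbelianVariety.isSmoothProjective_holds (A := A)) 1).piece 1 0 := by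
    intro i hi
    rcases hkind i with h | h
    · exact h.2
    · rw [h.1] at hi; exact absurd hi (by decide)
  have hkind1 : ∀ i, κ' i = 1 →
      cbσ i ∈ (BettiUniverse.hodge hHD (AbelianVariety.isSmoothProjective_holds (A := A)) 1).piece 0 1 := by
    intro i hi
    rcases hkind i with h | h
    · rw [h.1] at hi; exact absurd hi (by decide)
    · exact h.2
  -- letters
  set ρ := ofRatClassBaseChangeEquiv hX 1 with hρ
  set v : Module.Basis _ ℂ (complexBetti A.X 1) := cbσ.map ρ with hv
  set eL : Module.Basis _ ℂ (complexBetti A.X 1) := eC.map ρ with heL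
  have heLQ : ∀ i, IsRationalClass (eL i) := fun i => by
    rw [heL, Module.Basis.map_apply, heC, Algebra.TensorProduct.basis_apply, hρ,
      ofRatClassBaseChangeEquiv_apply, ofRatClassBaseChange_tmul, one_smul]
    exact isRationalClass_ofRatClass _
  have hv_apply : ∀ i, v i = ofRatClassBaseChange (Motives.ComplexPoints A.X) 1 (cb (e.symm i)) := fun i => by
    rw [hv, Module.Basis.map_apply, hcbσ, hρ, ofRatClassBaseChangeEquiv_apply]
  have hv0 : ∀ i, κ' i = 0 → IsOfHodgeType A.dim A.X 1 1 0 (v i) := by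
    intro i hi
    rw [hv, Module.Basis.map_apply, hρ, ofRatClassBaseChangeEquiv_apply,
      ← BettiUniverse.mem_hodge_piece_iff hHD hI hX (k := 1) (p := 1) (q := 0) rfl]
    exact hkind0 i hi
  have hv1 : ∀ i, κ' i = 1 → IsOfHodgeType A.dim A.X 1 0 1 (v i) := by
    intro i hi
    rw [hv, Module.Basis.map_apply, hρ, ofRatClassBaseChangeEquiv_apply,
      ← BettiUniverse.mem_hodge_piece_iff hHD hI hX (k := 1) (p := 0) (q := 1) rfl]
    exact hkind1 i hi
  -- (α) an antisymmetric kind-balanced coefficient function in the letters `g_j^* cbσ_i`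
  obtain ⟨ax, hax_bal, hax_anti, hcax⟩ := hg.exists_antisymm_kindBalanced_wordEval_eq v κ' hv0 hv1 hp hc
  -- the change of letters to the rational letters
  set G : Matrix _ _ ℂ := eC.toMatrix cbσ with hG
  set G' : Matrix _ _ ℂ := cbσ.toMatrix eC with hG'
  have hG'G : G' * G = 1 := cbσ.toMatrix_mul_toMatrix_flip eC
  have hve : ∀ i, v i = ∑ i', G i' i • eL i' := fun i => by
    simp only [hv, heL, Module.Basis.map_apply, ← map_smul, ← map_sum]
    congr 1
    exact (eC.sum_toMatrix_smul_self (v := ⇑cbσ) (j := i)).symm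
  have hletters : ∀ j i, avLetters g v (j, i) = ∑ i', G i' i • avLetters g eL (j, i') :=
    avLetters_baseChange g G hve
  set aE := colourChangeAt (fun _ : Fin n => G) ax with haE
  have haE_anti : IsAntisymm aE := hax_anti.colourChangeAt _
  have hcaE : wordEval F (avLetters g eL) aE = c := by
    rw [haE, ← wordEval_eq_wordEval_colourChangeAt F (fun _ : Fin n => G) hletters ax, hcax]
  -- rationality of `aE`
  obtain ⟨q, hq⟩ := hg.exists_rat_wordEval_eq eL heLQ hcQ
  obtain ⟨q', -, haEq⟩ := haE_anti.exists_eq_algebraMap_of_wordEval_eq hFinj (hg.letterBasis eL)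
    (q := q) (by rw [AVSlots.coe_letterBasis, hcaE, hFdef, hq])
  have hslice_e : ∀ u, wordSlice aE u = wordRepAt ℂ (fun _ : Fin (2 * p) => G) (wordSlice ax u) :=
    fun u => wordSlice_colourChangeAt (fun _ : Fin n => G) ax u
  -- the Hodge operator `Θ`: `diag(±1)` in the letters
  obtain ⟨Θ, hΘ⟩ := exists_hodgeTheta (BettiUniverse.hodge hHD (AbelianVariety.isSmoothProjective_holds (A := A)) 1)
  obtain ⟨-, -, hΘ10, hΘ01, -⟩ :=
    UnitaryTheta.theta_facts (BettiUniverse.hodge hHD (AbelianVariety.isSmoothProjective_holds (A := A)) 1)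
      hn1 heff hΘ
  have hΘb : ∀ i, Θ (cbσ i) = (if κ' i = 0 then (1 : ℂ) else -1) • cbσ i := by
    intro i
    rcases hkind i with ⟨h0, hmem⟩ | ⟨h1', hmem⟩
    · rw [h0, if_pos rfl, one_smul]
      exact hΘ10 _ hmem
    · rw [h1', if_neg one_ne_zero, neg_one_smul]
      exact hΘ01 _ hmem
  have hΘcb : LinearMap.toMatrix cbσ cbσ Θ = kindDiag κ' := by
    ext i i'
    rw [LinearMap.toMatrix_apply, hΘb, map_smul, Module.Basis.repr_self, Finsupp.smul_apply,
      Finsupp.single_apply, kindDiag, Matrix.diagonal_apply, smul_eq_mul, mul_ite, mul_one, mul_zero]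
    by_cases hii : i = i'
    · subst hii; rw [if_pos rfl]
    · rw [if_neg (Ne.symm hii), if_neg hii]
  have hJG : LinearMap.toMatrix eC eC Θ * G = G * kindDiag κ' := by
    rw [← hΘcb, hG, linearMap_toMatrix_mul_basis_toMatrix, basis_toMatrix_mul_linearMap_toMatrix]
  have hΘq : ∀ u : Fin (2 * p) → Fin n, wordDerAt ℂ (fun _ : Fin (2 * p) => LinearMap.toMatrix eC eC Θ)
      (wordSlice (fun w => algebraMap ℚ ℂ (q' w)) u) = 0 := by
    intro u
    rw [← haEq, hslice_e]
    refine wordDerAt_wordRepAt_eq_zero_of_mul_eq ℂ (fun _ : Fin (2 * p) => G) (fun _ => hJG) ?_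
    rw [wordDerAt_const]
    exact wordDer_kindDiag_wordSlice_eq_zero κ' hax_bal u
  -- the Gram matrix `Ω = J` of `ψ_ℂ` in the letters `Fin M`
  set ψC := ψ.form.baseChange ℂ with hψC
  set Ω : Matrix (Fin M) (Fin M) ℂ := Matrix.reindex e e (Matrix.J (Fin m) ℂ) with hΩdef
  have hΩ : ∀ i i', ψC (cbσ i) (cbσ i') = Ω i i' := fun i i' => by
    rw [hcbσ, hcbσ, hgram, hΩdef, Matrix.reindex_apply, Matrix.submatrix_apply]
  -- the invariance of every slice under `𝔰𝔭(Ω)`, via THEOREM L-Sp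
  have key : ∀ X : Matrix (Fin M) (Fin M) ℂ, Xᵀ * Ω + Ω * X = 0 → ∀ u : Fin (2 * p) → Fin n,
      wordDerAt ℂ (fun _ : Fin (2 * p) => X) (wordSlice ax u) = 0 := by
    intro X hXΩ u
    set Y := Matrix.toLin cbσ cbσ X with hYdef
    have hYcb : ∀ i, Y (cbσ i) = ∑ r, X r i • cbσ r := fun i => Matrix.toLin_self cbσ cbσ X i
    have hYskew : ∀ x y, ψC (Y x) y + ψC x (Y y) = 0 := by
      have hB : ψC ∘ₗ Y + ψC.compl₂ Y = 0 := by
        refine LinearMap.BilinForm.ext_basis cbσ fun i i' => ?_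
        rw [LinearMap.add_apply, LinearMap.add_apply, LinearMap.comp_apply, LinearMap.compl₂_apply,
          LinearMap.zero_apply, LinearMap.zero_apply, hYcb, hYcb, map_sum, LinearMap.sum_apply, map_sum]
        simp only [map_smul, LinearMap.smul_apply, smul_eq_mul, hΩ]
        have h := congr_fun (congr_fun hXΩ i) i'
        simp only [Matrix.add_apply, Matrix.mul_apply, Matrix.zero_apply, Matrix.transpose_apply] at h
        rw [Finset.sum_congr rfl fun r _ => mul_comm (X r i') (Ω i r)]
        exact h
      intro x y
      have h := LinearMap.congr_fun (LinearMap.congr_fun hB x) y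
      simpa only [LinearMap.add_apply, LinearMap.comp_apply, LinearMap.compl₂_apply, LinearMap.zero_apply]
        using h
    have hL := SymplecticThetaSix.wordDerAt_eq_zero_of_skew
      (BettiUniverse.hodge hHD (AbelianVariety.isSmoothProjective_holds (A := A)) 1) hn1 heff ψ hE hV eQ q' hΘ
      hΘq hYskew u
    rw [← haEq, hslice_e] at hL
    have hYG : ∀ _t : Fin (2 * p), LinearMap.toMatrix eC eC Y * G = G * LinearMap.toMatrix cbσ cbσ Y :=
      fun _ => by rw [hG, linearMap_toMatrix_mul_basis_toMatrix, basis_toMatrix_mul_linearMap_toMatrix]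
    have hblk : LinearMap.toMatrix cbσ cbσ Y = X := by
      rw [hYdef, LinearMap.toMatrix_toLin]
    have h3 : wordRepAt ℂ (fun _ : Fin (2 * p) => G)
        (wordDerAt ℂ (fun _ : Fin (2 * p) => X) (wordSlice ax u)) = 0 := by
      rw [← hblk, wordRepAt_wordDerAt_of_mul_eq ℂ (fun _ : Fin (2 * p) => G) hYG, hL]
    exact wordRepAt_injective ℂ (g := fun _ : Fin (2 * p) => G) (g' := fun _ : Fin (2 * p) => G')
      (funext fun _ => hG'G) (by rw [h3, map_zero])
  -- conclusion
  have hvfun : (⇑v : Fin M → complexBetti A.X 1) =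
      fun i => ofRatClassBaseChange (Motives.ComplexPoints A.X) 1 (cb (e.symm i)) := funext hv_apply
  refine ⟨ax, ?_, fun U X hXΩ => key X hXΩ U⟩
  rw [← hvfun]
  exact hcax

end Invariance

/-! ### §3 `B = D` for abelian varieties with slots over `A` -/

section Assembly

variable {A B : AbelianVariety ℂ} {n : ℕ} {g : Fin n → (B ⟶ A)}

open scoped Classical in
/-- **`Bᵖ(B) ⊆ Dᵖ(B) ⊗ ℂ` for an abelian variety `B` with slots over `A` of generic rank-six type** (data as in
`exists_symplecticInvariant_coeff`). Every rational `(p,p)`-class on `B` is a `ℂ`-combination of products of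
`p` rational `(1,1)`-classes: the slices of its coefficient function are killed by `𝔰𝔭(Ω)`
(`exists_symplecticInvariant_coeff`), hence fixed by every `h ∈ Sp(Ω)`
(`ClassicalInvariants.sum_prod_mul_eq_self_of_forall_wordDerAt_sp_eq_zero`, Goodman–Wallach Thm. 2.2.2: `Sp`
is generated by root unipotents), hence combinations of complete contractions of `Ω⁻¹` (tensor FFT for `Sp`,
Goodman–Wallach Thm. 5.3.3 (2), `mem_span_completeContraction_inv_of_sp_invariant`), each of which evaluates
on the letters to `±` a product of crossed classes `∑_{a,b} Ω⁻¹_{ab} g_s^* v_a ⌣ g_{s'}^* v_b`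
(`Milne1999.sum_completeContraction_smul_eq`, `Milne1999.sum_smul_cupPowOne_spPairWord_mem`; Milne Prop. 3.6 (a)
with Remark 3.7: "`(⋀^*(rH))^G = k[(⊗² rH)^G]` all `r ≥ 1`, (a) `G = Sp(φ)`"), and these are divisor classes:
`Ω⁻¹ = −Ω`, so the crossed class is `−(g_s, g_{s'})^*` of the polarization class of §2
(`Milne1999.sum_smul_cross_mem_span_rational_oneOne`, Milne Prop. 3.3). MZ99 (1.8): "`Hg(X) = Sp_D(V,φ) ⟺ …
D(Xⁿ) = B(Xⁿ) for all n`". [cite: MoonenZarhin1999LowDim, §1 (1.8) and §2 p. 715]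
[cite: Milne1999LefschetzClasses, Prop. 3.3, Prop. 3.6 (a), Remark 3.7 (pp. 652–656)]
[cite: GoodmanWallachGTM255, Thm. 2.2.2, Thm. 5.3.3 (2) and Thm. 5.3.5] -/
theorem AVSlots.symplecticHodgeClasses_divisorial_six [HodgeTensorFacts.{0, 0}] (hg : AVSlots A B g)
    (hHD : exists_isReal_hodgeModel) (hI : hodgePQ_independent_of_hodgeModel)
    (ψ : (BettiUniverse.hodge hHD (AbelianVariety.isSmoothProjective_holds (A := A)) 1).Polarization)
    (hE : ∀ a ∈ (BettiUniverse.hodge hHD (AbelianVariety.isSmoothProjective_holds (A := A)) 1).endAlg,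
      ∃ x : ℚ, a = x • 1)
    (hV : Module.finrank ℚ (bettiCohomology A.X 1) = 6)
    {m M : ℕ} (cb : Module.Basis (Fin m ⊕ Fin m) ℂ (ℂ ⊗[ℚ] bettiCohomology A.X 1)) (e : Fin m ⊕ Fin m ≃ Fin M)
    (hcb10 : ∀ k, cb (Sum.inr k) ∈
      (BettiUniverse.hodge hHD (AbelianVariety.isSmoothProjective_holds (A := A)) 1).piece 1 0)
    (hcb01 : ∀ k, cb (Sum.inl k) ∈
      (BettiUniverse.hodge hHD (AbelianVariety.isSmoothProjective_holds (A := A)) 1).piece 0 1)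
    (hgram : ∀ s s', ψ.form.baseChange ℂ (cb s) (cb s') = Matrix.J (Fin m) ℂ s s')
    (p : ℕ) (c : complexBetti B.X (2 * p)) (hcQ : IsRationalClass c)
    (hc : IsOfHodgeType B.dim B.X (2 * p) p p c) :
    c ∈ divisorClassesSpan B.X B.dim p := by
  classical
  rcases Nat.eq_zero_or_pos p with rfl | hp
  · exact AbelianVariety.mem_divisorClassesSpan_zero B c
  obtain ⟨a, hca, hkill⟩ := hg.exists_symplecticInvariant_coeff_six hHD hI ψ hE hV cb e hcb10 hcb01 hgram hp hcQ hc
  set v' : Fin M → complexBetti A.X 1 :=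
    fun i : Fin M => ofRatClassBaseChange (Motives.ComplexPoints A.X) 1 (cb (e.symm i)) with hv'
  have hv'apply : ∀ i, v' i = ofRatClassBaseChange (Motives.ComplexPoints A.X) 1 (cb (e.symm i)) := fun i => rfl
  set y : Fin n × Fin M → complexBetti B.X 1 := avLetters g v' with hy
  set F := cupPowOneAlt ℂ (Motives.ComplexPoints B.X) (2 * p) with hF
  -- the Gram matrix `Ω = J` in the letters: alternating, nondegenerate, `Ω⁻¹ = -Ω`
  set Ω : Matrix (Fin M) (Fin M) ℂ := Matrix.reindex e e (Matrix.J (Fin m) ℂ) with hΩdef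
  have hΩapply : ∀ i i', Ω i i' = Matrix.J (Fin m) ℂ (e.symm i) (e.symm i') := fun i i' => by
    rw [hΩdef, Matrix.reindex_apply, Matrix.submatrix_apply]
  have hΩt : ∀ i i', Ω i' i = -Ω i i' := fun i i' => by
    rw [hΩapply, hΩapply]
    have h := congr_fun (congr_fun (Matrix.J_transpose (Fin m) ℂ) (e.symm i)) (e.symm i')
    rw [Matrix.transpose_apply, Matrix.neg_apply] at h
    exact h
  have hΩa : (Matrix.toBilin' Ω).IsAlt := isAlt_toBilin'_of_forall_eq_neg hΩt
  have hΩdet : Ω.det ≠ 0 := by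
    rw [hΩdef, Matrix.det_reindex_self]
    exact (Matrix.isUnit_det_J (Fin m) ℂ).ne_zero
  have hΩn : (Matrix.toBilin' Ω).Nondegenerate :=
    LinearMap.BilinForm.nondegenerate_toBilin'_iff_det_ne_zero.2 hΩdet
  have hΩinv : Ω⁻¹ = -Ω := by
    rw [hΩdef, Matrix.inv_reindex, Matrix.J_inv]
    ext i j
    simp only [Matrix.reindex_apply, Matrix.submatrix_apply, Matrix.neg_apply]
  have hanti : ∀ a₁ a₂, Ω⁻¹ a₂ a₁ = -Ω⁻¹ a₁ a₂ := fun a₁ a₂ => by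
    rw [hΩinv, Matrix.neg_apply, Matrix.neg_apply, hΩt a₁ a₂]
  -- the crossed classes are divisor classes: `∑ Ω⁻¹_{ab} v_a ⌣ v_b = -Λ_ψ(1) ∈ B¹(A) ⊗ ℂ`
  have hθ := sum_smul_cupH1_symplecticHodgeBasis_mem_span_rational_oneOne hHD hI ψ cb hcb10 hcb01 hgram
  have hθA : (∑ a₁, ∑ a₂, Ω⁻¹ a₁ a₂ • cupProduct (rfl : 1 + 1 = 2) (v' a₁) (v' a₂)) ∈
      Submodule.span ℂ {c : complexBetti A.X 2 | IsRationalClass c ∧ IsOfHodgeType A.dim A.X 2 1 1 c} := by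
    have hre : ∑ a₁, ∑ a₂, Ω⁻¹ a₁ a₂ • cupProduct (rfl : 1 + 1 = 2) (v' a₁) (v' a₂) =
        -∑ s, ∑ s', Matrix.J (Fin m) ℂ s s' • cupH1 A (cb s) (cb s') := by
      rw [hΩinv, ← Finset.sum_neg_distrib, ← e.sum_comp]
      refine Fintype.sum_congr _ _ fun s => ?_
      rw [← Finset.sum_neg_distrib, ← e.sum_comp]
      refine Fintype.sum_congr _ _ fun s' => ?_
      rw [Matrix.neg_apply, hΩapply, hv'apply, hv'apply, e.symm_apply_apply, e.symm_apply_apply, neg_smul,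
        cupH1_apply]
    rw [hre]
    exact Submodule.neg_mem _ hθ
  -- every slice is an `Sp(Ω)`-invariant tensor (the unipotent bridge)
  have hinv : ∀ (t : Fin (2 * p) → Fin n) (h : Matrix (Fin M) (Fin M) ℂ), hᵀ * Ω * h = Ω →
      ∀ w' : Word M (2 * p), (∑ w, (∏ q, h (w' q) (w q)) * wordSlice a t w) = wordSlice a t w' :=
    fun t h hh w' => sum_prod_mul_eq_self_of_forall_wordDerAt_sp_eq_zero e (fun X hX => hkill t X hX) hh w'
  -- slice by slice: the tensor FFT for `Sp` and the evaluation of the complete contractions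
  rw [← hca, wordEval_eq_sum_wordSlice]
  refine Submodule.sum_mem _ fun t _ => ?_
  have hmem := mem_span_completeContraction_inv_of_sp_invariant hΩa hΩn (wordSlice a t) (hinv t)
  set Λ := Fintype.linearCombination ℂ (fun ε : Word M (2 * p) => F (fun q => y (t q, ε q))) with hΛ
  have hΛapply : ∀ cf : Word M (2 * p) → ℂ, Λ cf = ∑ ε, cf ε • F (fun q => y (t q, ε q)) :=
    fun cf => Fintype.linearCombination_apply ℂ _ cf
  rw [← hΛapply]
  refine (Submodule.span_le (p := (divisorClassesSpan B.X B.dim p).comap Λ)).2 ?_ hmem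
  rintro _ ⟨e', rfl⟩
  rw [SetLike.mem_coe, Submodule.mem_comap, hΛapply]
  obtain ⟨π, -, hsum⟩ := Milne1999.sum_completeContraction_smul_eq F Ω⁻¹ e' y t
  rw [hsum]
  refine Submodule.smul_mem _ _ ?_
  simp_rw [hF, cupPowOneAlt_apply]
  refine Milne1999.sum_smul_cupPowOne_spPairWord_mem Ω⁻¹ y p _ _ fun c' => ?_
  simp only [hy, avLetters_apply]
  exact Milne1999.sum_smul_cross_mem_span_rational_oneOne (g _) (g _) v' Ω⁻¹ hanti hθA

/-- **`IsDivisorGenerated B` (the tree's spelling of `B•(B) = D•(B) ⊗ ℂ`) for every abelian variety `B` with slots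
over a complex abelian variety `A` with `dim_ℚ H¹(A; ℚ) = 6` and `End_Hdg(H¹(A; ℚ)) = ℚ`** — the symplectic
Hodge basis of §1 read in the letters `Fin (m + m)` feeds `symplecticHodgeClasses_divisorial`. MZ99 (2.3) with
p. 715: "`Hg(X) = Sp(V,φ) ≅ Sp_{6,ℚ}`", "`B(Xⁿ) = D(Xⁿ)` for all `n`". [cite: MoonenZarhin1999LowDim, §2 (2.3) and p. 715]
[cite: vanGeemen1994HodgeAV, Thm. 4.2] [cite: Milne1999LefschetzClasses, Prop. 3.6 (a) and Cor. 4.5] -/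
theorem AVSlots.isDivisorGenerated_of_endHodge_rat_of_rank_six [HodgeTensorFacts.{0, 0}] (hg : AVSlots A B g)
    (hHD : exists_isReal_hodgeModel) (hI : hodgePQ_independent_of_hodgeModel)
    (ψ : (BettiUniverse.hodge hHD (AbelianVariety.isSmoothProjective_holds (A := A)) 1).Polarization)
    (hE : ∀ a ∈ (BettiUniverse.hodge hHD (AbelianVariety.isSmoothProjective_holds (A := A)) 1).endAlg,
      ∃ x : ℚ, a = x • 1)
    (hV : Module.finrank ℚ (bettiCohomology A.X 1) = 6) : IsDivisorGenerated B := by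
  classical
  haveI : Module.Finite ℚ (bettiCohomology A.X 1) := finite_bettiCohomology_one A
  have hX : IsSmoothProjective A.dim A.X := AbelianVariety.isSmoothProjective_holds
  have heff := BettiUniverse.hodge_isEffective hHD hX 1
  obtain ⟨cb, hcb10, hcb01, hgram⟩ := SymplecticTheta.exists_symplecticHodgeBasis
    (BettiUniverse.hodge hHD (AbelianVariety.isSmoothProjective_holds (A := A)) 1) Nat.cast_one heff ψ
  exact fun p c hcQ hc =>
    hg.symplecticHodgeClasses_divisorial_six hHD hI ψ hE hV cb finSumFinEquiv hcb10 hcb01 hgram p c hcQ hc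

end Assembly

/-! ### §4 Abelian threefolds with `End⁰(A) = ℚ`: all powers, the Hodge conjecture, the isogeny class -/

section Threefold

variable {A B : AbelianVariety ℂ} {n : ℕ} {g : Fin n → (B ⟶ A)}


/-- **`B•(B) = D•(B) ⊗ ℂ` for every abelian variety `B` with slots over an abelian THREEFOLD `A` with
`End⁰(A) = ℚ` (`finrank_ℚ End⁰(A) = 1`) — UNCONDITIONAL.** Assembled from
`AVSlots.isDivisorGenerated_of_endHodge_rat_of_rank_six`: `dim_ℚ H¹(A; ℚ) = 2·dim A = 6`
(`finrank_bettiCohomology_one`), `End_Hdg(H¹) = ℚ` (`exists_eq_smul_one_of_finrank_endAlgebra_eq_one`), a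
polarization of `H¹(A(ℂ); ℚ)` (`smoothProjective_hodgeStructure_isPolarizable_holds`), and the tree's own
`exists_isReal_hodgeModel_holds`, `hodgePQ_independent_of_hodgeModel_holds`, `hodgeTensorFacts_holds`.
MZ99 (2.3) Type I(1). [cite: MoonenZarhin1999LowDim, §2 (2.3) and p. 715] [cite: vanGeemen1994HodgeAV, Thm. 4.2] -/
theorem AVSlots.isDivisorGenerated_of_threefold_endRankOne (hg : AVSlots A B g)
    (h1 : Module.finrank ℚ A.endAlgebra = 1) (hdim : A.dim = 3) : IsDivisorGenerated B := by
  classical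
  have hHD : exists_isReal_hodgeModel := exists_isReal_hodgeModel_holds
  have hI : hodgePQ_independent_of_hodgeModel := hodgePQ_independent_of_hodgeModel_holds
  haveI : HodgeTensorFacts.{0, 0} := hodgeTensorFacts_holds.{0, 0}
  have hX : IsSmoothProjective A.dim A.X := AbelianVariety.isSmoothProjective_holds
  obtain ⟨ψ⟩ : (BettiUniverse.hodge hHD (AbelianVariety.isSmoothProjective_holds (A := A)) 1).IsPolarizable :=
    smoothProjective_hodgeStructure_isPolarizable_holds hX (BettiUniverse.realHodgeModel hHD hX)
      (BettiUniverse.realHodgeModel_isHodgeSymmetric hHD hX) 1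
  have hV : Module.finrank ℚ (bettiCohomology A.X 1) = 6 := by rw [finrank_bettiCohomology_one A, hdim]
  exact hg.isDivisorGenerated_of_endHodge_rat_of_rank_six hHD hI ψ
    (exists_eq_smul_one_of_finrank_endAlgebra_eq_one hHD hI h1 (by omega)) hV

/-- **`Lie Hg(A) = 𝔰𝔭(H¹(A; ℚ), ψ)` for an abelian threefold with `End⁰(A) = ℚ`** — Moonen–Zarhin 1999 (2.3) Type
I(1) "`Hg(X) = Sp(V,φ) ≅ Sp_{6,ℚ}`" in Lie form, for EVERY polarization `ψ` of `H¹(A(ℂ); ℚ)`: an endomorphism of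
`H¹(A; ℚ)` lies in the Lie algebra of the Hodge group iff it is `ψ`-skew (the tree's
`SymplecticThetaSix.mem_hodgeLie_iff_skew` with `dim_ℚ H¹ = 6` and `End_Hdg(H¹) = ℚ`; the instance `HodgeTensorFacts` is
the tree's `hodgeTensorFacts_holds`). [cite: MoonenZarhin1999LowDim, §2 (2.3)] [cite: Gordon1997, §1.6.2 and Thm. 7.5] -/
theorem mem_hodgeLie_iff_skew_of_threefold_endRankOne [HodgeTensorFacts.{0, 0}] (hHD : exists_isReal_hodgeModel)
    (hI : hodgePQ_independent_of_hodgeModel) (h1 : Module.finrank ℚ A.endAlgebra = 1) (hdim : A.dim = 3)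
    (ψ : (BettiUniverse.hodge hHD (AbelianVariety.isSmoothProjective_holds (A := A)) 1).Polarization)
    (X : Module.End ℚ (bettiCohomology A.X 1)) :
    X ∈ (BettiUniverse.hodge hHD (AbelianVariety.isSmoothProjective_holds (A := A)) 1).hodgeLie ↔
      ∀ v w, ψ.form (X v) w + ψ.form v (X w) = 0 := by
  haveI : Module.Finite ℚ (bettiCohomology A.X 1) := finite_bettiCohomology_one A
  have hX : IsSmoothProjective A.dim A.X := AbelianVariety.isSmoothProjective_holds
  have hV : Module.finrank ℚ (bettiCohomology A.X 1) = 6 := by rw [finrank_bettiCohomology_one A, hdim]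
  exact SymplecticThetaSix.mem_hodgeLie_iff_skew _ Nat.cast_one (BettiUniverse.hodge_isEffective hHD hX 1) ψ
    (exists_eq_smul_one_of_finrank_endAlgebra_eq_one hHD hI h1 (by omega)) hV X

end Threefold

/-- **Moonen–Zarhin 1999 (2.3) Type I(1) with p. 715, all powers — UNCONDITIONAL: `B•(A^{N+1}) = D•(A^{N+1}) ⊗ ℂ`**
for a complex abelian threefold `A` with `End⁰(A) = ℚ` (`finrank_ℚ End⁰(A) = 1`): "`Hg(X) = Sp(V,φ) ≅ Sp_{6,ℚ}`",
"it follows that `B(Xⁿ) = D(Xⁿ)` for all `n`". (For `g = 3` this is Tankeev–Ribet at the prime `3` in the generic case `End⁰ = ℚ`.)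
[cite: MoonenZarhin1999LowDim, §2 (2.3) and p. 715] [cite: vanGeemen1994HodgeAV, Thm. 4.2] -/
theorem AbelianVariety.isDivisorGenerated_powSucc_of_threefold_endRankOne (A : AbelianVariety ℂ)
    (h1 : Module.finrank ℚ A.endAlgebra = 1) (hdim : A.dim = 3) (N : ℕ) : IsDivisorGenerated (A.powSucc N) :=
  (AVSlots.powSucc A N).isDivisorGenerated_of_threefold_endRankOne h1 hdim

/-- `A` itself: `B•(A) = D•(A) ⊗ ℂ` for an abelian threefold with `End⁰(A) = ℚ`.
[cite: MoonenZarhin1999LowDim, §2 (2.3)] -/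
theorem AbelianVariety.isDivisorGenerated_of_threefold_endRankOne (A : AbelianVariety ℂ)
    (h1 : Module.finrank ℚ A.endAlgebra = 1) (hdim : A.dim = 3) : IsDivisorGenerated A :=
  (avSlots_self A).isDivisorGenerated_of_threefold_endRankOne h1 hdim

/-- **The Hodge conjecture for all powers `A^{N+1}` of a complex abelian threefold with `End⁰(A) = ℚ` —
UNCONDITIONAL** (`B = D` above with Lefschetz `(1,1)`: the tree's `hodgeConjectureFor_of_isDivisorGenerated`).
MZ99 p. 715: "In particular the Hodge conjecture is true for all such `Xⁿ`."
[cite: MoonenZarhin1999LowDim, §2 p. 715 and (2.2)] [cite: vanGeemen1994HodgeAV, Thm. 4.2 and §2.4] -/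
theorem hodgeConjectureFor_powSucc_of_threefold_endRankOne (A : AbelianVariety ℂ)
    (h1 : Module.finrank ℚ A.endAlgebra = 1) (hdim : A.dim = 3) (N : ℕ) :
    HodgeConjectureFor (A.powSucc N).dim (A.powSucc N).X :=
  hodgeConjectureFor_of_isDivisorGenerated _
    (AbelianVariety.isDivisorGenerated_powSucc_of_threefold_endRankOne A h1 hdim N)

/-- **The Hodge conjecture for `A` itself**, an abelian threefold with `End⁰(A) = ℚ` (`N = 0`-free spelling; for a
threefold this is Lefschetz `(1,1)` plus hard Lefschetz). [cite: MoonenZarhin1999LowDim, §2 (2.3)] -/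
theorem hodgeConjectureFor_of_threefold_endRankOne (A : AbelianVariety ℂ)
    (h1 : Module.finrank ℚ A.endAlgebra = 1) (hdim : A.dim = 3) : HodgeConjectureFor A.dim A.X :=
  hodgeConjectureFor_of_isDivisorGenerated _ (AbelianVariety.isDivisorGenerated_of_threefold_endRankOne A h1 hdim)

/-- **The Hodge conjecture for every complex abelian variety isogenous to a power of an abelian threefold with
`End⁰(A) = ℚ`** (van Geemen Lemma 3.7 = the tree's `HodgeConjectureFor.of_isIsogenous`).
[cite: vanGeemen1994HodgeAV, Lemma 3.7 and Thm. 4.2] [cite: MoonenZarhin1999LowDim, §2 (2.3)] -/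
theorem hodgeConjectureFor_of_isIsogenous_powSucc_of_threefold_endRankOne {A B' : AbelianVariety ℂ}
    (h1 : Module.finrank ℚ A.endAlgebra = 1) (hdim : A.dim = 3) {N : ℕ} (hB : B'.IsIsogenous (A.powSucc N)) :
    HodgeConjectureFor B'.dim B'.X :=
  HodgeConjectureFor.of_isIsogenous hB (hodgeConjectureFor_powSucc_of_threefold_endRankOne A h1 hdim N)

/-- **The `g = 3` instance of the content of the named fact
`Tankeev1996_hodgeClassesAlgebraic_powers_simple_endRankOne_notEx1`** (`TankeevExceptionalNumbersHodgeClasses`: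
"on every power of a simple complex abelian variety `A` with `End⁰(A) = ℚ` whose dimension is not in `Ex(1)`,
every rational `(m,m)`-class is algebraic"; `3 ∉ Ex(1) = {4^l, ½ C(4l+2,2l+1)^{2m−1}, 2^{8lm+4l−4m−3},
4^l (m+1)^{2l+1} : l, m ≥ 1}`), now a THEOREM for `dim A = 3` (simplicity is automatic: `End⁰ = ℚ`).
[cite: Tankeev1996, Thm. 1.1 (first case)] [cite: Gordon1997, Thm. 10.8] [cite: MoonenZarhin1999LowDim, §2 (2.3)] -/
theorem hodgeClasses_algebraic_powSucc_of_threefold_endRankOne (A : AbelianVariety ℂ)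
    (h1 : Module.finrank ℚ A.endAlgebra = 1) (hdim : A.dim = 3) (N m : ℕ)
    (c : complexBetti (A.powSucc N).X (2 * m)) (hc : IsRationalClass c)
    (hmm : IsOfHodgeType (A.powSucc N).dim (A.powSucc N).X (2 * m) m m c) :
    c ∈ algebraicClasses (A.powSucc N).X m :=
  (hodgeConjectureFor_powSucc_of_threefold_endRankOne A h1 hdim N).2 m c hc hmm

end Literature.AlgebraicGeometry.HodgeTheory

end
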